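import Summits.Ventures.QEC.Census.LP.LP112w5.Distance
import Summits.Ventures.QEC.Census.LPTyped
import HarnessLib

/-!
# `LP112w5` IS Panteleev–Kalachev's lifted product `LP(A, [b])`, `A = [1 1; 1 x⁷]`, `b = 1 + x + x⁵` over `𝔽₂[x]/(x²⁸ − 1)` — the census row `[[112, 6, 8]]` on the TYPED construction

The census object `LP112w5.cert.code _` (explicit check words, `Census/LP/LP112w5/Cert.lean`; census id `LPb_2x2_l28_b0-1-5_E0-0.0-7`,
cell D.1-lite) is, along the layout bijections of `Census/LPTyped.lean` (`r = 28·i + a`, `q = 28·c + t`), EXACTLY the flat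
check-matrix pair `(𝔅H_X(A,[b]), 𝔅H_Z(A,[b]))` of the typed lifted product `LPTyped.lpCode 28 E [0, 1, 5]`
(`Literature/…/LiftedProduct.lean`: `LiftedProduct.xMatrix` / `zMatrix` over `28 × 28` circulant blocks): `HX_eq`, `HZ_eq`
by `decide +kernel` on the product-free entry formulas `LiftedProduct.xMatrix_eq_of_xEntry` / `zMatrix_eq_of_zEntry`
(56 × 112 and 56 × 112 entries). Hence the row's KERNEL theorem `LP112w5.isCode` transports (type-05 FACT P,
`CSSCode.isCode_iff_of_submatrix`) to **`isCode_lp : (lpCode 28 E [0, 1, 5]).IsCode 112 6 8`** — a `[[112,6,8]]` theorem about the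
TYPED Panteleev–Kalachev construction, not just about a list of words. Tier KERNEL, axioms standard, no `native_decide`.
qec-search-4 g3 (`tools/emit_typed.py LPb_2x2_l28_b0-1-5_E0-0.0-7 LP112w5`).
-/

set_option autoImplicit false

namespace Summit.Ventures.QEC.Census.LP112w5

open Matrix Literature.InformationTheory.QuantumCodes LiftedProduct Summit.Ventures.QEC.Census.LPTyped

/-- Exponent matrix `E` of `A = [1 1; 1 x⁷]` (2 × 2). (definition) -/
def E : Fin 2 → Fin 2 → ℕ := ![![0, 0], ![0, 7]]

/-- **The census object's `H^X` is `𝔅(H_X(A, [b]))` relabelled** (`decide +kernel` over all `56 × 112` entries of the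
product-free entry formula). -/
theorem HX_eq : (LP112w5.cert.code (LP112w5.cert.commOK_of_checkStructure checkStructure_ok)).HX =
    (lpCode 28 E [0, 1, 5]).HX.submatrix ((finCongr (by decide)).trans (rowEquiv 2 28))
      ((finCongr (by decide)).trans (colEquiv 2 2 28)) := by
  change rowMatrix _ _ = (xMatrix _ _).submatrix _ _
  rw [xMatrix_eq_of_xEntry]
  decide +kernel

/-- **The census object's `H^Z` is `𝔅(H_Z(A, [b]))` relabelled** (`decide +kernel`, `56 × 112` entries). -/
theorem HZ_eq : (LP112w5.cert.code (LP112w5.cert.commOK_of_checkStructure checkStructure_ok)).HZ =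
    (lpCode 28 E [0, 1, 5]).HZ.submatrix ((finCongr (by decide)).trans (rowEquiv 2 28))
      ((finCongr (by decide)).trans (colEquiv 2 2 28)) := by
  change rowMatrix _ _ = (zMatrix _ _).submatrix _ _
  rw [zMatrix_eq_of_zEntry]
  decide +kernel

/-- **Panteleev–Kalachev's `LP(A, [b])` with `A = [1 1; 1 x⁷]`, `b = 1 + x + x⁵` over `𝔽₂[x]/(x²⁸ − 1)` is a `[[112, 6, 8]]` code** —
the KERNEL census row `LP112w5.isCode` transported to the typed construction by type-05's FACT P
(`CSSCode.isCode_iff_of_submatrix` with `HX_eq`, `HZ_eq`). [cite: PanteleevKalachev2022LP] -/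
theorem isCode_lp : (lpCode 28 E [0, 1, 5]).IsCode 112 6 8 :=
  (CSSCode.isCode_iff_of_submatrix HX_eq HZ_eq 112 6 8).1 isCode

/-- **The census object is a lifted-product code** in the sense of qec-type-07's predicate `IsLiftedProduct` (PARTITION row 07):
witnesses `ℓ = 28`, `A = monoBlocks 28 E` (2 × 2), `B = polyBlock 28 [0, 1, 5]` (1 × 1), the layout bijections, element-wise
commutation of circulant blocks, and `HX_eq` / `HZ_eq`. (appended, qec-search-4 g3) [cite: PanteleevKalachev2022LP, §III.D (arXiv:2012.04068 chunk p0011 L41-44)] -/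
theorem isLiftedProduct : IsLiftedProduct (LP112w5.cert.code (LP112w5.cert.commOK_of_checkStructure checkStructure_ok)).HX (LP112w5.cert.code (LP112w5.cert.commOK_of_checkStructure checkStructure_ok)).HZ :=
  ⟨28, 2, 2, 1, 1, monoBlocks 28 E, polyBlock 28 [0, 1, 5], (finCongr (by decide)).trans (rowEquiv 2 28),
    (finCongr (by decide)).trans (rowEquiv 2 28), (finCongr (by decide)).trans (colEquiv 2 2 28),
    elementwiseCommute_mono_poly 28 E [0, 1, 5], HX_eq, HZ_eq⟩

end Summit.Ventures.QEC.Census.LP112w5
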